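import Literature.NumberTheory.EllipticCurves.EisensteinNumberDistribution
import HarnessLib

/-!
# Twisted torsion sums of Eisenstein numbers as rational expressions in `℘`:
# `Σ_i Φ(i) E₁(w − t_i; L) = ½ ℘′(w) Σ_i Φ(i)/(℘(w) − ℘(t_i))` for an even weight with `Σ Φ = 0`

Topic `Literature/NumberTheory/EllipticCurves` (complex-lattice cluster), continuing `EisensteinNumberDistribution.lean`;
deliberate dot-notation extensions of Mathlib's `PeriodPair`. Everything is proved; no definition, no named fact.

For ANY lattice `Λ` (period pair `L`), any finite family of points `t : ι → ℂ` closed under negation modulo `Λ`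
(an equivalence `e : ι ≃ ι` with `t(e i) + t(i) ∈ Λ`) and any weight `Φ : ι → ℂ` that is even (`Φ(e i) = Φ(i)`), vanishes at the
indices with `t_i ∈ Λ`, and has total sum `Σ_i Φ(i) = 0`, the weight-one Eisenstein numbers `E₁(z; L) = ζ(z; L) − η(z; L)` of Rubin,
LNM 1716, Def. 7.11 (`PeriodPair.eisensteinE₁`) satisfy, at every `w ∉ Λ` with `℘(w) ≠ ℘(t_i)` for the `t_i ∉ Λ`:

  **`Σ_i Φ(i) · E₁(w − t_i; L) = ½ · ℘′(w; L) · Σ_i Φ(i)/(℘(w; L) − ℘(t_i; L))`**  (`sum_mul_eisensteinE₁_sub_eq`),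

and `= 0` at every `w ∈ Λ` (`sum_mul_eisensteinE₁_sub_eq_zero_of_mem`). Proof: pairing `i ↔ e i` turns the sum into
`½ Σ_i Φ(i)(E₁(w + t_i) + E₁(w − t_i))`, and `E₁(w + v) + E₁(w − v) − 2E₁(w) = ℘′(w)/(℘(w) − ℘(v))` (`eisensteinE₁_add_add_sub`: the
tree's `ζ`-form `PeriodPair.weierstrassZeta_add_add_sub`, Armitage–Eberlein (7.64), plus the `ℝ`-linearity of the quasi-period map `η`);
the multiple of `E₁(w)` dies with `Σ Φ = 0`. In the normalised coordinates `X = ℘/ϖ²`, `Y = ℘′/(2ϖ³)` of any model (`ϖ ≠ 0`):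
`Σ_i Φ(i) E₁(w − t_i; L) = ϖ · Y(w) · Σ_i Φ(i)/(X(w) − X(t_i))` (`sum_mul_eisensteinE₁_sub_eq_varpi_mul`).

These are the ELLIPTIC-FUNCTION-FREE forms of the character-twisted torsion sums `Σ_{b mod 𝔣} χ(b) E₁(w − t_b; L)` through which the
finite formulae for weight-one Hecke `L`-values at `s = 1` (`BinaryLatticeKroneckerLimit`, `QuadraticOrderEisensteinNumbers`,
`GaussianLatticeHeckeLValue`) enter integrality questions: for `ℤi + ℤ` and `Φ = conj((·/7)₄)^k` this is the BSD programme's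
`…ManinDatumSupercuspidalCMInertTorsionSumRational.torsionSum_eq_half_deriv_mul_sum` (stated there for the Gaussian `E₁*` and the
labelling `rep`); the present file is the lattice-generic statement (used for `ℤρ + ℤ`, `Φ = (·/5)₆^k`).

## References
* K. Rubin, *Elliptic curves with complex multiplication and the conjecture of Birch and Swinnerton-Dyer*, LNM 1716 (1999), §7.4,
  Def. 7.11, Prop. 7.12 (held: `book:coates1999-arithmetic-theory-elliptic-curves`, pp. 244–245). [Rubin1999]
* J. V. Armitage, W. F. Eberlein, *Elliptic Functions*, LMS Student Texts 67 (2006), §7.4.2 eq. (7.64). [ArmitageEberlein2001]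

## Mathlib / tree search
Tree: `PeriodPair.eisensteinE₁` / `eisensteinE₁_def` (`BinaryLatticeKroneckerLimit`); `eisensteinE₁_add_of_mem_lattice`,
`eisensteinE₁_sub_of_mem_lattice`, `eisensteinE₁_neg` (`EisensteinNumberDistribution`); `PeriodPair.weierstrassZeta_add_add_sub`,
`weierstrassZeta_add_holds` (`WeierstrassAddition(Proofs)`). Mathlib: `Equiv.sum_comp`, `Finset.sum_congr`.
-/

noncomputable section

open Complex

namespace PeriodPair

variable (L : PeriodPair)

/-- **`E₁(w + v) + E₁(w − v) − 2E₁(w) = ℘′(w)/(℘(w) − ℘(v))`** for `w, v ∉ Λ` with `℘(w) ≠ ℘(v)`: the `ζ` addition formula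
(Armitage–Eberlein (7.64)) survives the passage to `E₁ = ζ − η` because `η` is `ℝ`-linear. [cite: ArmitageEberlein2001, §7.4.2 eq. (7.64)] -/
theorem eisensteinE₁_add_add_sub {w v : ℂ} (hw : w ∉ L.lattice) (hv : v ∉ L.lattice) (hne : ℘[L] w ≠ ℘[L] v) :
    L.eisensteinE₁ (w + v) + L.eisensteinE₁ (w - v) - 2 * L.eisensteinE₁ w = ℘'[L] w / (℘[L] w - ℘[L] v) := by
  rw [← weierstrassZeta_add_add_sub L.weierstrassZeta_add_holds hw hv hne]
  simp only [eisensteinE₁_def, map_add, map_sub]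
  ring

variable {ι : Type*} [Fintype ι]

/-- **Pairing `i ↔ e i`**: for a family `t` closed under negation modulo `Λ` (`t(e i) + t(i) ∈ Λ`) and an `e`-invariant weight,
`Σ_i Φ(i) E₁(w − t_i) = Σ_i Φ(i) E₁(w + t_i)`. [cite: Rubin1999, §7.4 Def. 7.11] -/
theorem sum_mul_eisensteinE₁_sub_eq_sum_add (e : ι ≃ ι) (t : ι → ℂ) (ht : ∀ i, t (e i) + t i ∈ L.lattice)
    (Φ : ι → ℂ) (hΦe : ∀ i, Φ (e i) = Φ i) (w : ℂ) :
    ∑ i, Φ i * L.eisensteinE₁ (w - t i) = ∑ i, Φ i * L.eisensteinE₁ (w + t i) := by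
  rw [← Equiv.sum_comp e (fun i ↦ Φ i * L.eisensteinE₁ (w - t i))]
  refine Finset.sum_congr rfl fun i _ ↦ ?_
  rw [hΦe, show w - t (e i) = (w + t i) - (t (e i) + t i) by ring, L.eisensteinE₁_sub_of_mem_lattice (ht i)]

/-- **The twisted torsion sum vanishes at lattice points**: for `w ∈ Λ`, `Σ_i Φ(i) E₁(w − t_i; L) = 0` (pairing `i ↔ e i`,
`E₁` odd and `Λ`-periodic). [cite: Rubin1999, §7.4 Def. 7.11] -/
theorem sum_mul_eisensteinE₁_sub_eq_zero_of_mem (e : ι ≃ ι) (t : ι → ℂ) (ht : ∀ i, t (e i) + t i ∈ L.lattice)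
    (Φ : ι → ℂ) (hΦe : ∀ i, Φ (e i) = Φ i) {w : ℂ} (hw : w ∈ L.lattice) :
    ∑ i, Φ i * L.eisensteinE₁ (w - t i) = 0 := by
  have h1 := L.sum_mul_eisensteinE₁_sub_eq_sum_add e t ht Φ hΦe w
  have h2 : ∑ i, Φ i * L.eisensteinE₁ (w - t i) = -∑ i, Φ i * L.eisensteinE₁ (w + t i) := by
    rw [← Finset.sum_neg_distrib]
    refine Finset.sum_congr rfl fun i _ ↦ ?_
    rw [show w - t i = -(w + t i) + (w + w) by ring, L.eisensteinE₁_add_of_mem_lattice (add_mem hw hw), L.eisensteinE₁_neg]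
    ring
  have h3 : ∑ i, Φ i * L.eisensteinE₁ (w + t i) = 0 := by linear_combination (h2 - h1) / 2
  rw [h1, h3]

/-- ★ **Twisted torsion sums of Eisenstein numbers as rational expressions in `℘`.** For a finite family `t : ι → ℂ` closed under
negation modulo `Λ` (`t(e i) + t(i) ∈ Λ`), a weight `Φ` with `Φ(e i) = Φ(i)`, `Φ(i) = 0` whenever `t_i ∈ Λ`, and `Σ_i Φ(i) = 0`, and a point
`w ∉ Λ` with `℘(w) ≠ ℘(t_i)` for all `t_i ∉ Λ`:
`Σ_i Φ(i) E₁(w − t_i; L) = ½ ℘′(w) Σ_i Φ(i)/(℘(w) − ℘(t_i))`. [cite: Rubin1999, §7.4 Def. 7.11, Prop. 7.12]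
[cite: ArmitageEberlein2001, §7.4.2 eq. (7.64)] -/
theorem sum_mul_eisensteinE₁_sub_eq (e : ι ≃ ι) (t : ι → ℂ) (ht : ∀ i, t (e i) + t i ∈ L.lattice)
    (Φ : ι → ℂ) (hΦe : ∀ i, Φ (e i) = Φ i) (hΦ0 : ∀ i, t i ∈ L.lattice → Φ i = 0) (hΦsum : ∑ i, Φ i = 0)
    {w : ℂ} (hw : w ∉ L.lattice) (hne : ∀ i, t i ∉ L.lattice → ℘[L] w ≠ ℘[L] (t i)) :
    ∑ i, Φ i * L.eisensteinE₁ (w - t i) = (1 / 2 : ℂ) * ℘'[L] w * ∑ i, Φ i / (℘[L] w - ℘[L] (t i)) := by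
  have h1 := L.sum_mul_eisensteinE₁_sub_eq_sum_add e t ht Φ hΦe w
  -- `2·S = Σ Φ (E₁(w + t) + E₁(w − t))`
  have h2 : 2 * ∑ i, Φ i * L.eisensteinE₁ (w - t i) =
      ∑ i, Φ i * (L.eisensteinE₁ (w + t i) + L.eisensteinE₁ (w - t i)) := by
    rw [two_mul]
    nth_rewrite 1 [h1]
    rw [← Finset.sum_add_distrib]
    exact Finset.sum_congr rfl fun i _ ↦ by ring
  -- termwise addition formula
  have h3 : ∑ i, Φ i * (L.eisensteinE₁ (w + t i) + L.eisensteinE₁ (w - t i)) =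
      ∑ i, (Φ i * (2 * L.eisensteinE₁ w) + ℘'[L] w * (Φ i / (℘[L] w - ℘[L] (t i)))) := by
    refine Finset.sum_congr rfl fun i _ ↦ ?_
    by_cases hti : t i ∈ L.lattice
    · rw [hΦ0 i hti]; ring
    · have key := L.eisensteinE₁_add_add_sub hw hti (hne i hti)
      have hd : ℘[L] w - ℘[L] (t i) ≠ 0 := sub_ne_zero.mpr (hne i hti)
      rw [show L.eisensteinE₁ (w + t i) + L.eisensteinE₁ (w - t i) = 2 * L.eisensteinE₁ w + ℘'[L] w / (℘[L] w - ℘[L] (t i)) by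
        linear_combination key]
      ring
  rw [h3, Finset.sum_add_distrib, ← Finset.sum_mul, ← Finset.mul_sum, hΦsum, zero_mul, zero_add] at h2
  linear_combination (1 / 2 : ℂ) * h2

/-- **Normalised coordinates.** With `X = ℘/ϖ²`, `Y = ℘′/(2ϖ³)` (`ϖ ≠ 0`; e.g. `ϖ = ϖ₀` for `ℤi + ℤ` on `y² = x³ − x`, `ϖ = ϖ₁` for `ℤρ + ℤ` on
`y² = x³ − 1`), under the hypotheses of `sum_mul_eisensteinE₁_sub_eq`:
`Σ_i Φ(i) E₁(w − t_i; L) = ϖ · Y(w) · Σ_i Φ(i)/(X(w) − X(t_i))`. [cite: Rubin1999, §7.4 Def. 7.11, Prop. 7.12] -/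
theorem sum_mul_eisensteinE₁_sub_eq_varpi_mul (e : ι ≃ ι) (t : ι → ℂ) (ht : ∀ i, t (e i) + t i ∈ L.lattice)
    (Φ : ι → ℂ) (hΦe : ∀ i, Φ (e i) = Φ i) (hΦ0 : ∀ i, t i ∈ L.lattice → Φ i = 0) (hΦsum : ∑ i, Φ i = 0)
    {w : ℂ} (hw : w ∉ L.lattice) (hne : ∀ i, t i ∉ L.lattice → ℘[L] w ≠ ℘[L] (t i)) {ϖ : ℂ} (hϖ : ϖ ≠ 0) :
    ∑ i, Φ i * L.eisensteinE₁ (w - t i) =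
      ϖ * (℘'[L] w / (2 * ϖ ^ 3)) * ∑ i, Φ i / (℘[L] w / ϖ ^ 2 - ℘[L] (t i) / ϖ ^ 2) := by
  rw [L.sum_mul_eisensteinE₁_sub_eq e t ht Φ hΦe hΦ0 hΦsum hw hne, Finset.mul_sum, Finset.mul_sum]
  refine Finset.sum_congr rfl fun i _ ↦ ?_
  rw [← sub_div, div_div_eq_mul_div]
  field_simp

end PeriodPair

end
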